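import Mathlib
import HarnessLib
import Summits.HubbardSuperconductivity.HubbardSuperconductivity.Theorems.KLProgrammeKLRegimeEngineTwoLegCellDictionary
import Summits.HubbardSuperconductivity.HubbardSuperconductivity.Theorems.KLProgrammeKLRegimeEngineTowerModelDefs

/-!
# Route `KLProgramme` — crux K3 ENGINE (stmt-HubbardSuperconductivity-20437 `KLRegimeEngineV17F2`), row (b), E1 docket item (2) «(E2)-CELL-READER», part 2:
# THE INPUT-FAMILY TWO-LEG CELL `klWtPinnedSumOf … J 2 T q w` IS A SUM OVER PARTNER LABELS OF MOMENT-WEIGHTED `ℓ¹` NORMS OF ONE-PAIR CHARACTER SUMS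

Cell `gate-hubbard-kl`, seat hubbard-kl-k3c2-p3 (g19).  Sequel of `…EngineTwoLegCellDictionary` (part 1).  The (E2) object of row (b)'s E1 family `hE₁` (pen (R440)(A))
is the WEIGHTED pinned sum `klWtPinnedSumOf L M β μ K J 2 T q w = ε_x·Σ_{X : X q = w} klScaleWt_J(pos X)·‖kernel (map E(F_J) T) 2 X‖` at the thin anisotropic family
`F_J = klAnisoFamily … J` (E1 blueprint §2; `…EngineTowerModelDefs`).  For ANY Grassmann element `T` whose `2`-kernel is conserving-diagonal on every label string
(`kernel T 2 ((k_i,σ_i),c_i) = [k̄₀ = k̄₁]·g_τ(k̄₀)`; anomalous strings `c₀ = c₁` carry `g_τ = 0` — for `𝒱_i[K]` the selection rule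
`kernel_hubbardEffectiveActionCT_eq_zero_of_spinCharge`):

* §3 `pinSum_two_zero_le` / `pinSum_two_one_le` — at a fixed partner label `ℓ′`, the sum over the partner position is ONE moment-weighted `ℓ¹` norm
  `Σ_z w_J(z)·‖Σ_Q χ̄_Q(z)•(F_ω(Q̃)F_{ω′}(Q̃)g_τ(Q))‖` (dictionary of part 1; `klScaleWt ≤` moment weight, p3's `klScaleWt_pair_latticeLegPos_le`; the creator/annihilator sign is
  absorbed by the evenness of the weight);
* §4 **`wtPinnedCell_two_le_sum_momentWt_charSum`** (general family) and **`klWtPinnedSumOf_two_le_sum_momentWt_charSum`** (the engine's cell):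
  `klWtPinnedSumOf L M β μ K J 2 T q w ≤ ε_x·Σ_{ℓ′} Σ_z w_J(z)·‖Σ_Q χ̄_Q(z)•(F_{J,ω}(Q̃)·F_{J,ω′}(Q̃)·g_{τ(q)}(Q))‖`; interface form `klWtPinnedSumOf_two_le_of_pairBounds`.
  CONSEQUENCE FOR THE E1 DOCKET: the cell reads the two-leg symbol ONLY on the supports of the partner products `F_{J,ω}·F_{J,ω′}` — the space-time cutoff
  `C_h⁻¹(√(k₀² + e_K(k⃗)²))` of `bgmMultiplier` times two adjacent angular sectors — so the large-`k₀` floor of the located «2LEG-PLAIN-CURRENCY» (plain family, no cutoff)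
  is NOT read by (E2); each pair term is bounded from ORDER-THREE symbol data by p3's `sliceCharSumWt_l1_le_of_data` (sequel `…EngineTwoLegCellReaderData`).

Everything is proved; no definitions, no named facts; the conserving-diagonal form is a HYPOTHESIS on `T`; nothing here asserts (E2), any engine row, K3 or
superconductivity. [folklore]  References: BGM 2006 §2.7 (2.70), §2.8 (2.76), (2.81), §3 (3.3) [cite: BenfattoGiulianiMastropietro2006].
-/

noncomputable section

namespace Summit.HubbardSuperconductivity.HubbardSuperconductivity.Theorems.TorusFourierL2

set_option linter.dupNamespace false -- summit = problem name (single-conjunct summit), D-0017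

open Finset Complex Literature.Probability.LatticeModels Literature.MathematicalPhysics.QuantumLattice
open Literature.MathematicalPhysics.QuantumLattice.GrassmannAlgebra
open Summit.HubbardSuperconductivity.HubbardSuperconductivity.Theorems.KLRegimeSplit
open Summit.HubbardSuperconductivity.HubbardSuperconductivity.Theorems.KLProgrammeLegKernels
open Summit.HubbardSuperconductivity.HubbardSuperconductivity.Theorems.EngineV8
open scoped Real ComplexConjugate

variable {L M : ℕ} [NeZero L] [NeZero M]

/-! ### §3 The pinned sum over the free leg at a fixed free label: leg `0` pinned, leg `1` pinned -/

/-- **Pinned leg `0`, free label `ℓ′` fixed**: for a conserving-diagonal `2`-kernel (normal strings: symbol `g_τ`; anomalous strings: `g_τ = 0`),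
`Σ_y klScaleWt_n{pos w, pos (y,ℓ′)}·‖kernel (map E(F) T) 2 ![w, (y,ℓ′)]‖ ≤ Σ_z w_n(z)·‖Σ_Q χ̄_Q(z)•(F_ω(Q̃)·F_{ω′}(Q̃)·g_τ(Q))‖`,
`τ = ((σ,c), (σ′,c′))`, with the moment weight `w_n(z) = 1 + (Λ_nβ/2M)|z̃₁| + Λ_n|z̃₂,₁| + Λ_n|z̃₂,₂|`. [cite: BenfattoGiulianiMastropietro2006, §2.7 (2.70), §2.8 (2.76)] -/
theorem pinSum_two_zero_le {N : ℕ} {β : ℝ} (hβ : 0 < β) (F : Fin N → FreqMomentum L M → ℂ) (T : HubbardGrassmann L M)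
    (g : (Fin 2 → Fin 2 × Fin 2) → TorusSite 1 (2 * M) × TorusSite 2 L → ℂ)
    (hker : ∀ (τ : Fin 2 → Fin 2 × Fin 2) (k : Fin 2 → FreqMomentum L M), kernel ℂ T 2 (fun i => ((k i, (τ i).1), (τ i).2)) =
      if ((fun _ : Fin 1 => (((k 0).1 : ℕ) : ZMod (2 * M))), (k 0).2) = (((fun _ : Fin 1 => (((k 1).1 : ℕ) : ZMod (2 * M))), (k 1).2) : TorusSite 1 (2 * M) × TorusSite 2 L)
      then g τ ((fun _ : Fin 1 => (((k 0).1 : ℕ) : ZMod (2 * M))), (k 0).2) else 0)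
    (hanom : ∀ τ : Fin 2 → Fin 2 × Fin 2, (τ 0).2 = (τ 1).2 → g τ = 0)
    (n : ℕ) (w : SpaceTimeIdx L M × SectorLeg N) (ℓ' : SectorLeg N) :
    ∑ y : SpaceTimeIdx L M, klScaleWt L M β n (((univ : Finset (Fin 2)).image ![w, (y, ℓ')]).image (latticeLegPos (2 * (2 * M)))) *
        ‖kernel ℂ (ExteriorAlgebra.map (Matrix.toLin' (sectorAnalysisMatrix L M β F)) T) 2 ![w, (y, ℓ')]‖ ≤
      ∑ z : TorusSite 1 (2 * M) × TorusSite 2 L,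
        (1 + klScale klE0 n * β / (2 * M) * |(((z.1 0).valMinAbs : ℤ) : ℝ)| + klScale klE0 n * |(((z.2 0).valMinAbs : ℤ) : ℝ)| +
            klScale klE0 n * |(((z.2 1).valMinAbs : ℤ) : ℝ)|) *
          ‖∑ Q : TorusSite 1 (2 * M) × TorusSite 2 L, (torusChar Q.1 z.1 * torusChar Q.2 z.2) •
            (F w.2.1.1 (⟨(Q.1 0).val, ZMod.val_lt (Q.1 0)⟩, Q.2) * F ℓ'.1.1 (⟨(Q.1 0).val, ZMod.val_lt (Q.1 0)⟩, Q.2) *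
              g ![(w.2.1.2, w.2.2), (ℓ'.1.2, ℓ'.2)] Q)‖ := by
  classical
  haveI : NeZero (2 * M) := ⟨by have := NeZero.ne M; omega⟩
  have hβ0 : β ≠ 0 := hβ.ne'
  set τ : Fin 2 → Fin 2 × Fin 2 := ![(w.2.1.2, w.2.2), (ℓ'.1.2, ℓ'.2)] with hτ
  set G : TorusSite 1 (2 * M) × TorusSite 2 L → ℂ := fun Q =>
    F w.2.1.1 (⟨(Q.1 0).val, ZMod.val_lt (Q.1 0)⟩, Q.2) * F ℓ'.1.1 (⟨(Q.1 0).val, ZMod.val_lt (Q.1 0)⟩, Q.2) * g τ Q with hG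
  -- the dictionary on the string `τ`
  have hker' : ∀ k : Fin 2 → FreqMomentum L M,
      kernel ℂ T 2 (fun i => ((k i, (![w.2.1.2, ℓ'.1.2] : Fin 2 → Fin 2) i), (![w.2.2, ℓ'.2] : Fin 2 → Fin 2) i)) =
      if ((fun _ : Fin 1 => (((k 0).1 : ℕ) : ZMod (2 * M))), (k 0).2) = (((fun _ : Fin 1 => (((k 1).1 : ℕ) : ZMod (2 * M))), (k 1).2) : TorusSite 1 (2 * M) × TorusSite 2 L)
      then g τ ((fun _ : Fin 1 => (((k 0).1 : ℕ) : ZMod (2 * M))), (k 0).2) else 0 := by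
    intro k
    have hlab : (fun i => ((k i, (![w.2.1.2, ℓ'.1.2] : Fin 2 → Fin 2) i), (![w.2.2, ℓ'.2] : Fin 2 → Fin 2) i)) =
        (fun i => ((k i, (τ i).1), (τ i).2)) := by
      funext i; fin_cases i <;> rfl
    rw [hlab]; exact hker τ k
  have hkn : ∀ y : SpaceTimeIdx L M,
      ‖kernel ℂ (ExteriorAlgebra.map (Matrix.toLin' (sectorAnalysisMatrix L M β F)) T) 2 ![w, (y, ℓ')]‖ =
      ‖∑ Q : TorusSite 1 (2 * M) × TorusSite 2 L,
        (torusChar Q.1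
            ((if w.2.2 = 0 then -(((fun _ : Fin 1 => ((w.1.1 : ℕ) : ZMod (2 * M))), w.1.2) : TorusSite 1 (2 * M) × TorusSite 2 L)
              else (((fun _ : Fin 1 => ((w.1.1 : ℕ) : ZMod (2 * M))), w.1.2) : TorusSite 1 (2 * M) × TorusSite 2 L)) +
            (if ℓ'.2 = 0 then -(((fun _ : Fin 1 => ((y.1 : ℕ) : ZMod (2 * M))), y.2) : TorusSite 1 (2 * M) × TorusSite 2 L)
              else (((fun _ : Fin 1 => ((y.1 : ℕ) : ZMod (2 * M))), y.2) : TorusSite 1 (2 * M) × TorusSite 2 L))).1 *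
          torusChar Q.2
            ((if w.2.2 = 0 then -(((fun _ : Fin 1 => ((w.1.1 : ℕ) : ZMod (2 * M))), w.1.2) : TorusSite 1 (2 * M) × TorusSite 2 L)
              else (((fun _ : Fin 1 => ((w.1.1 : ℕ) : ZMod (2 * M))), w.1.2) : TorusSite 1 (2 * M) × TorusSite 2 L)) +
            (if ℓ'.2 = 0 then -(((fun _ : Fin 1 => ((y.1 : ℕ) : ZMod (2 * M))), y.2) : TorusSite 1 (2 * M) × TorusSite 2 L)
              else (((fun _ : Fin 1 => ((y.1 : ℕ) : ZMod (2 * M))), y.2) : TorusSite 1 (2 * M) × TorusSite 2 L))).2) • G Q‖ := by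
    intro y
    rw [kernel_map_sectorAnalysis]
    have e1 : (fun i => ((![w, (y, ℓ')] : Fin 2 → SpaceTimeIdx L M × SectorLeg N) i).2) =
        fun i => (((![w.2.1.1, ℓ'.1.1] : Fin 2 → Fin N) i, (![w.2.1.2, ℓ'.1.2] : Fin 2 → Fin 2) i), (![w.2.2, ℓ'.2] : Fin 2 → Fin 2) i) := by
      funext i; fin_cases i <;> rfl
    have e2 : (fun i => ((![w, (y, ℓ')] : Fin 2 → SpaceTimeIdx L M × SectorLeg N) i).1) = ![w.1, y] := by
      funext i; fin_cases i <;> rfl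
    rw [e1, e2, norm_sectorisedKernel_two_eq_norm_charSum hβ0 F T _ _ (g τ) hker' _ _]
    simp only [Matrix.cons_val_zero, Matrix.cons_val_one, hG, smul_eq_mul]
  have hwt : ∀ y : SpaceTimeIdx L M,
      klScaleWt L M β n (((univ : Finset (Fin 2)).image ![w, (y, ℓ')]).image (latticeLegPos (2 * (2 * M)))) ≤
      1 + klScale klE0 n * β / (2 * M) * |(((((w.1.1 : ℕ) : ZMod (2 * M)) - ((y.1 : ℕ) : ZMod (2 * M))).valMinAbs : ℤ) : ℝ)| +
        klScale klE0 n * |((((w.1.2 - y.2) 0).valMinAbs : ℤ) : ℝ)| + klScale klE0 n * |((((w.1.2 - y.2) 1).valMinAbs : ℤ) : ℝ)| := by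
    intro y
    rw [image_image_vec_two]
    exact klScaleWt_pair_latticeLegPos_le hβ.le n w (y, ℓ')
  by_cases hc : w.2.2 = ℓ'.2
  · -- anomalous string: the symbol vanishes
    have hg0 : g τ = 0 := hanom τ (by simp [hτ, hc])
    have hG0 : G = 0 := by funext Q; simp [hG, hg0]
    have hL : ∀ y : SpaceTimeIdx L M,
        klScaleWt L M β n (((univ : Finset (Fin 2)).image ![w, (y, ℓ')]).image (latticeLegPos (2 * (2 * M)))) *
          ‖kernel ℂ (ExteriorAlgebra.map (Matrix.toLin' (sectorAnalysisMatrix L M β F)) T) 2 ![w, (y, ℓ')]‖ = 0 := by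
      intro y; rw [hkn y, hG0]; simp
    rw [Finset.sum_eq_zero fun y _ => hL y]
    refine Finset.sum_nonneg fun z _ => mul_nonneg ?_ (norm_nonneg _)
    exact momentWt_nonneg (by have := (klth_klScale_pos n).le; positivity) (klth_klScale_pos n).le z
  · -- normal string: the charges are `(0,1)` or `(1,0)`
    obtain hw | hw : w.2.2 = 0 ∨ w.2.2 = 1 := Fin.exists_fin_two.mp ⟨w.2.2, rfl⟩
    · have hl : ℓ'.2 = 1 := by
        obtain hl | hl : ℓ'.2 = 0 ∨ ℓ'.2 = 1 := Fin.exists_fin_two.mp ⟨ℓ'.2, rfl⟩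
        · exact absurd (hw.trans hl.symm) hc
        · exact hl
      -- `−w̄ + ȳ = −(w̄ − ȳ)`
      have hpt : ∀ y : SpaceTimeIdx L M,
          -(((fun _ : Fin 1 => ((w.1.1 : ℕ) : ZMod (2 * M))), w.1.2) : TorusSite 1 (2 * M) × TorusSite 2 L) +
            (((fun _ : Fin 1 => ((y.1 : ℕ) : ZMod (2 * M))), y.2) : TorusSite 1 (2 * M) × TorusSite 2 L) =
          -(((fun _ : Fin 1 => ((w.1.1 : ℕ) : ZMod (2 * M)) - ((y.1 : ℕ) : ZMod (2 * M))), w.1.2 - y.2) : TorusSite 1 (2 * M) × TorusSite 2 L) := by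
        intro y
        refine Prod.ext ?_ ?_
        · funext j; simp only [Prod.fst_add, Prod.fst_neg, Pi.add_apply, Pi.neg_apply, neg_sub]; ring
        · simp only [Prod.snd_add, Prod.snd_neg, neg_sub]; abel
      refine sum_pinned_le_sum_momentWt_of_neg β n w.1 G _ _ hwt fun y => ?_
      rw [hkn y]
      simp only [hw, hl, if_true, one_ne_zero, if_false, hpt y]
    · have hl : ℓ'.2 = 0 := by
        obtain hl | hl : ℓ'.2 = 0 ∨ ℓ'.2 = 1 := Fin.exists_fin_two.mp ⟨ℓ'.2, rfl⟩
        · exact hl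
        · exact absurd (hw.trans hl.symm) hc
      -- `w̄ + (−ȳ) = w̄ − ȳ`
      have hpt : ∀ y : SpaceTimeIdx L M,
          (((fun _ : Fin 1 => ((w.1.1 : ℕ) : ZMod (2 * M))), w.1.2) : TorusSite 1 (2 * M) × TorusSite 2 L) +
            -(((fun _ : Fin 1 => ((y.1 : ℕ) : ZMod (2 * M))), y.2) : TorusSite 1 (2 * M) × TorusSite 2 L) =
          (((fun _ : Fin 1 => ((w.1.1 : ℕ) : ZMod (2 * M)) - ((y.1 : ℕ) : ZMod (2 * M))), w.1.2 - y.2) : TorusSite 1 (2 * M) × TorusSite 2 L) := by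
        intro y
        refine Prod.ext ?_ ?_
        · funext j; simp only [Prod.fst_add, Prod.fst_neg, Pi.add_apply, Pi.neg_apply]; ring
        · simp only [Prod.snd_add, Prod.snd_neg]; abel
      refine sum_pinned_le_sum_momentWt_of_pos β n w.1 G _ _ hwt fun y => ?_
      rw [hkn y]
      simp only [hw, hl, if_true, one_ne_zero, if_false, hpt y]


/-- **Pinned leg `1`, free label `ℓ′` fixed** (the twin with the free leg FIRST in the string: `τ = ((σ′,c′), (σ,c))`):
`Σ_y klScaleWt_n{pos (y,ℓ′), pos w}·‖kernel (map E(F) T) 2 ![(y,ℓ′), w]‖ ≤ Σ_z w_n(z)·‖Σ_Q χ̄_Q(z)•(F_ω(Q̃)·F_{ω′}(Q̃)·g_τ(Q))‖`.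
[cite: BenfattoGiulianiMastropietro2006, §2.7 (2.70), §2.8 (2.76)] -/
theorem pinSum_two_one_le {N : ℕ} {β : ℝ} (hβ : 0 < β) (F : Fin N → FreqMomentum L M → ℂ) (T : HubbardGrassmann L M)
    (g : (Fin 2 → Fin 2 × Fin 2) → TorusSite 1 (2 * M) × TorusSite 2 L → ℂ)
    (hker : ∀ (τ : Fin 2 → Fin 2 × Fin 2) (k : Fin 2 → FreqMomentum L M), kernel ℂ T 2 (fun i => ((k i, (τ i).1), (τ i).2)) =
      if ((fun _ : Fin 1 => (((k 0).1 : ℕ) : ZMod (2 * M))), (k 0).2) = (((fun _ : Fin 1 => (((k 1).1 : ℕ) : ZMod (2 * M))), (k 1).2) : TorusSite 1 (2 * M) × TorusSite 2 L)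
      then g τ ((fun _ : Fin 1 => (((k 0).1 : ℕ) : ZMod (2 * M))), (k 0).2) else 0)
    (hanom : ∀ τ : Fin 2 → Fin 2 × Fin 2, (τ 0).2 = (τ 1).2 → g τ = 0)
    (n : ℕ) (w : SpaceTimeIdx L M × SectorLeg N) (ℓ' : SectorLeg N) :
    ∑ y : SpaceTimeIdx L M, klScaleWt L M β n (((univ : Finset (Fin 2)).image ![(y, ℓ'), w]).image (latticeLegPos (2 * (2 * M)))) *
        ‖kernel ℂ (ExteriorAlgebra.map (Matrix.toLin' (sectorAnalysisMatrix L M β F)) T) 2 ![(y, ℓ'), w]‖ ≤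
      ∑ z : TorusSite 1 (2 * M) × TorusSite 2 L,
        (1 + klScale klE0 n * β / (2 * M) * |(((z.1 0).valMinAbs : ℤ) : ℝ)| + klScale klE0 n * |(((z.2 0).valMinAbs : ℤ) : ℝ)| +
            klScale klE0 n * |(((z.2 1).valMinAbs : ℤ) : ℝ)|) *
          ‖∑ Q : TorusSite 1 (2 * M) × TorusSite 2 L, (torusChar Q.1 z.1 * torusChar Q.2 z.2) •
            (F w.2.1.1 (⟨(Q.1 0).val, ZMod.val_lt (Q.1 0)⟩, Q.2) * F ℓ'.1.1 (⟨(Q.1 0).val, ZMod.val_lt (Q.1 0)⟩, Q.2) *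
              g ![(ℓ'.1.2, ℓ'.2), (w.2.1.2, w.2.2)] Q)‖ := by
  classical
  haveI : NeZero (2 * M) := ⟨by have := NeZero.ne M; omega⟩
  have hβ0 : β ≠ 0 := hβ.ne'
  set τ : Fin 2 → Fin 2 × Fin 2 := ![(ℓ'.1.2, ℓ'.2), (w.2.1.2, w.2.2)] with hτ
  set G : TorusSite 1 (2 * M) × TorusSite 2 L → ℂ := fun Q =>
    F w.2.1.1 (⟨(Q.1 0).val, ZMod.val_lt (Q.1 0)⟩, Q.2) * F ℓ'.1.1 (⟨(Q.1 0).val, ZMod.val_lt (Q.1 0)⟩, Q.2) * g τ Q with hG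
  have hker' : ∀ k : Fin 2 → FreqMomentum L M,
      kernel ℂ T 2 (fun i => ((k i, (![ℓ'.1.2, w.2.1.2] : Fin 2 → Fin 2) i), (![ℓ'.2, w.2.2] : Fin 2 → Fin 2) i)) =
      if ((fun _ : Fin 1 => (((k 0).1 : ℕ) : ZMod (2 * M))), (k 0).2) = (((fun _ : Fin 1 => (((k 1).1 : ℕ) : ZMod (2 * M))), (k 1).2) : TorusSite 1 (2 * M) × TorusSite 2 L)
      then g τ ((fun _ : Fin 1 => (((k 0).1 : ℕ) : ZMod (2 * M))), (k 0).2) else 0 := by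
    intro k
    have hlab : (fun i => ((k i, (![ℓ'.1.2, w.2.1.2] : Fin 2 → Fin 2) i), (![ℓ'.2, w.2.2] : Fin 2 → Fin 2) i)) =
        (fun i => ((k i, (τ i).1), (τ i).2)) := by
      funext i; fin_cases i <;> rfl
    rw [hlab]; exact hker τ k
  have hkn : ∀ y : SpaceTimeIdx L M,
      ‖kernel ℂ (ExteriorAlgebra.map (Matrix.toLin' (sectorAnalysisMatrix L M β F)) T) 2 ![(y, ℓ'), w]‖ =
      ‖∑ Q : TorusSite 1 (2 * M) × TorusSite 2 L,
        (torusChar Q.1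
            ((if ℓ'.2 = 0 then -(((fun _ : Fin 1 => ((y.1 : ℕ) : ZMod (2 * M))), y.2) : TorusSite 1 (2 * M) × TorusSite 2 L)
              else (((fun _ : Fin 1 => ((y.1 : ℕ) : ZMod (2 * M))), y.2) : TorusSite 1 (2 * M) × TorusSite 2 L)) +
            (if w.2.2 = 0 then -(((fun _ : Fin 1 => ((w.1.1 : ℕ) : ZMod (2 * M))), w.1.2) : TorusSite 1 (2 * M) × TorusSite 2 L)
              else (((fun _ : Fin 1 => ((w.1.1 : ℕ) : ZMod (2 * M))), w.1.2) : TorusSite 1 (2 * M) × TorusSite 2 L))).1 *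
          torusChar Q.2
            ((if ℓ'.2 = 0 then -(((fun _ : Fin 1 => ((y.1 : ℕ) : ZMod (2 * M))), y.2) : TorusSite 1 (2 * M) × TorusSite 2 L)
              else (((fun _ : Fin 1 => ((y.1 : ℕ) : ZMod (2 * M))), y.2) : TorusSite 1 (2 * M) × TorusSite 2 L)) +
            (if w.2.2 = 0 then -(((fun _ : Fin 1 => ((w.1.1 : ℕ) : ZMod (2 * M))), w.1.2) : TorusSite 1 (2 * M) × TorusSite 2 L)
              else (((fun _ : Fin 1 => ((w.1.1 : ℕ) : ZMod (2 * M))), w.1.2) : TorusSite 1 (2 * M) × TorusSite 2 L))).2) • G Q‖ := by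
    intro y
    rw [kernel_map_sectorAnalysis]
    have e1 : (fun i => ((![(y, ℓ'), w] : Fin 2 → SpaceTimeIdx L M × SectorLeg N) i).2) =
        fun i => (((![ℓ'.1.1, w.2.1.1] : Fin 2 → Fin N) i, (![ℓ'.1.2, w.2.1.2] : Fin 2 → Fin 2) i), (![ℓ'.2, w.2.2] : Fin 2 → Fin 2) i) := by
      funext i; fin_cases i <;> rfl
    have e2 : (fun i => ((![(y, ℓ'), w] : Fin 2 → SpaceTimeIdx L M × SectorLeg N) i).1) = ![y, w.1] := by
      funext i; fin_cases i <;> rfl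
    rw [e1, e2, norm_sectorisedKernel_two_eq_norm_charSum hβ0 F T _ _ (g τ) hker' _ _]
    simp only [Matrix.cons_val_zero, Matrix.cons_val_one, hG, smul_eq_mul, mul_comm (F ℓ'.1.1 _) (F w.2.1.1 _)]
  have hwt : ∀ y : SpaceTimeIdx L M,
      klScaleWt L M β n (((univ : Finset (Fin 2)).image ![(y, ℓ'), w]).image (latticeLegPos (2 * (2 * M)))) ≤
      1 + klScale klE0 n * β / (2 * M) * |(((((w.1.1 : ℕ) : ZMod (2 * M)) - ((y.1 : ℕ) : ZMod (2 * M))).valMinAbs : ℤ) : ℝ)| +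
        klScale klE0 n * |((((w.1.2 - y.2) 0).valMinAbs : ℤ) : ℝ)| + klScale klE0 n * |((((w.1.2 - y.2) 1).valMinAbs : ℤ) : ℝ)| := by
    intro y
    rw [image_image_vec_two, Finset.pair_comm]
    exact klScaleWt_pair_latticeLegPos_le hβ.le n w (y, ℓ')
  by_cases hc : w.2.2 = ℓ'.2
  · have hg0 : g τ = 0 := hanom τ (by simp [hτ, hc])
    have hG0 : G = 0 := by funext Q; simp [hG, hg0]
    have hL : ∀ y : SpaceTimeIdx L M,
        klScaleWt L M β n (((univ : Finset (Fin 2)).image ![(y, ℓ'), w]).image (latticeLegPos (2 * (2 * M)))) *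
          ‖kernel ℂ (ExteriorAlgebra.map (Matrix.toLin' (sectorAnalysisMatrix L M β F)) T) 2 ![(y, ℓ'), w]‖ = 0 := by
      intro y; rw [hkn y, hG0]; simp
    rw [Finset.sum_eq_zero fun y _ => hL y]
    refine Finset.sum_nonneg fun z _ => mul_nonneg ?_ (norm_nonneg _)
    exact momentWt_nonneg (by have := (klth_klScale_pos n).le; positivity) (klth_klScale_pos n).le z
  · obtain hw | hw : w.2.2 = 0 ∨ w.2.2 = 1 := Fin.exists_fin_two.mp ⟨w.2.2, rfl⟩
    · have hl : ℓ'.2 = 1 := by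
        obtain hl | hl : ℓ'.2 = 0 ∨ ℓ'.2 = 1 := Fin.exists_fin_two.mp ⟨ℓ'.2, rfl⟩
        · exact absurd (hw.trans hl.symm) hc
        · exact hl
      -- `ȳ + (−w̄) = −(w̄ − ȳ)`
      have hpt : ∀ y : SpaceTimeIdx L M,
          (((fun _ : Fin 1 => ((y.1 : ℕ) : ZMod (2 * M))), y.2) : TorusSite 1 (2 * M) × TorusSite 2 L) +
            -(((fun _ : Fin 1 => ((w.1.1 : ℕ) : ZMod (2 * M))), w.1.2) : TorusSite 1 (2 * M) × TorusSite 2 L) =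
          -(((fun _ : Fin 1 => ((w.1.1 : ℕ) : ZMod (2 * M)) - ((y.1 : ℕ) : ZMod (2 * M))), w.1.2 - y.2) : TorusSite 1 (2 * M) × TorusSite 2 L) := by
        intro y
        refine Prod.ext ?_ ?_
        · funext j; simp only [Prod.fst_add, Prod.fst_neg, Pi.add_apply, Pi.neg_apply, neg_sub]; ring
        · simp only [Prod.snd_add, Prod.snd_neg, neg_sub]; abel
      refine sum_pinned_le_sum_momentWt_of_neg β n w.1 G _ _ hwt fun y => ?_
      rw [hkn y]
      simp only [hw, hl, if_true, one_ne_zero, if_false, hpt y]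
    · have hl : ℓ'.2 = 0 := by
        obtain hl | hl : ℓ'.2 = 0 ∨ ℓ'.2 = 1 := Fin.exists_fin_two.mp ⟨ℓ'.2, rfl⟩
        · exact hl
        · exact absurd (hw.trans hl.symm) hc
      -- `−ȳ + w̄ = w̄ − ȳ`
      have hpt : ∀ y : SpaceTimeIdx L M,
          -(((fun _ : Fin 1 => ((y.1 : ℕ) : ZMod (2 * M))), y.2) : TorusSite 1 (2 * M) × TorusSite 2 L) +
            (((fun _ : Fin 1 => ((w.1.1 : ℕ) : ZMod (2 * M))), w.1.2) : TorusSite 1 (2 * M) × TorusSite 2 L) =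
          (((fun _ : Fin 1 => ((w.1.1 : ℕ) : ZMod (2 * M)) - ((y.1 : ℕ) : ZMod (2 * M))), w.1.2 - y.2) : TorusSite 1 (2 * M) × TorusSite 2 L) := by
        intro y
        refine Prod.ext ?_ ?_
        · funext j; simp only [Prod.fst_add, Prod.fst_neg, Pi.add_apply, Pi.neg_apply]; ring
        · simp only [Prod.snd_add, Prod.snd_neg]; abel
      refine sum_pinned_le_sum_momentWt_of_pos β n w.1 G _ _ hwt fun y => ?_
      rw [hkn y]
      simp only [hw, hl, if_true, one_ne_zero, if_false, hpt y]


/-! ### §4 THE READER: the weighted two-leg cell at a general family, and the engine's input-family cell `klWtPinnedSumOf … J 2` -/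

/-- **THE WEIGHTED TWO-LEG CELL OF A CONSERVING QUADRATIC AT A GENERAL MULTIPLIER FAMILY IS A SUM OVER THE FREE LEG'S LABELS OF WEIGHTED `ℓ¹` NORMS
OF ONE-PAIR CHARACTER SUMS.**  Data: `0 < β`; a family `F` of `N` multipliers; a Grassmann element `T` whose `2`-kernel is conserving-diagonal through the
torus images on EVERY label string `τ = ((σ_i, c_i))_{i<2}` — `kernel T 2 ((k_i,σ_i),c_i) = [k̄₀ = k̄₁]·g_τ(k̄₀)` — with `g_τ = 0` on the anomalous strings
`c₀ = c₁` (for an effective action: the `U(1)` selection rule); a weight scale `n`; a pinned leg `q` with pin `w = (x, ((ω,σ),c))`.  THEN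
`ε_x·Σ_{X : X q = w} klScaleWt_n(pos X)·‖kernel (map E(F) T) 2 X‖ ≤ ε_x·Σ_{ℓ′=((ω′,σ′),c′)} Σ_z w_n(z)·‖Σ_Q χ̄_Q(z)•(F_ω(Q̃)·F_{ω′}(Q̃)·g_{τ(q)}(Q))‖`,
`τ(q)` the string with `(σ,c)` at leg `q` and `(σ′,c′)` at the other leg, `w_n(z) = 1 + (Λ_nβ/2M)|z̃₁| + Λ_n|z̃₂,₁| + Λ_n|z̃₂,₂|` the moment weight of
`sum_wt_norm_charSum_le_of_third_differences` at `s₀ = Λ_nβ/(2M)`, `s₁ = Λ_n` — to each pair `…SectorSliceCharSumMoment.sliceCharSumWt_l1_le_of_data` applies with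
`c₀ = 1`, `M = F_ω·F_{ω′}`, `Ψ = g_τ`. [cite: BenfattoGiulianiMastropietro2006, §2.7 (2.70), §2.8 (2.76), (2.81)] -/
theorem wtPinnedCell_two_le_sum_momentWt_charSum {N : ℕ} {β : ℝ} (hβ : 0 < β) (F : Fin N → FreqMomentum L M → ℂ) (T : HubbardGrassmann L M)
    (g : (Fin 2 → Fin 2 × Fin 2) → TorusSite 1 (2 * M) × TorusSite 2 L → ℂ)
    (hker : ∀ (τ : Fin 2 → Fin 2 × Fin 2) (k : Fin 2 → FreqMomentum L M), kernel ℂ T 2 (fun i => ((k i, (τ i).1), (τ i).2)) =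
      if ((fun _ : Fin 1 => (((k 0).1 : ℕ) : ZMod (2 * M))), (k 0).2) = (((fun _ : Fin 1 => (((k 1).1 : ℕ) : ZMod (2 * M))), (k 1).2) : TorusSite 1 (2 * M) × TorusSite 2 L)
      then g τ ((fun _ : Fin 1 => (((k 0).1 : ℕ) : ZMod (2 * M))), (k 0).2) else 0)
    (hanom : ∀ τ : Fin 2 → Fin 2 × Fin 2, (τ 0).2 = (τ 1).2 → g τ = 0)
    (n : ℕ) (q : Fin 2) (w : SpaceTimeIdx L M × SectorLeg N) :
    imagTimeWeight β M ^ (2 - 1) * ∑ X ∈ univ.filter (fun X : Fin 2 → SpaceTimeIdx L M × SectorLeg N => X q = w),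
        klScaleWt L M β n ((univ.image X).image (latticeLegPos (2 * (2 * M)))) *
          ‖kernel ℂ (ExteriorAlgebra.map (Matrix.toLin' (sectorAnalysisMatrix L M β F)) T) 2 X‖ ≤
      imagTimeWeight β M * ∑ ℓ' : SectorLeg N, ∑ z : TorusSite 1 (2 * M) × TorusSite 2 L,
        (1 + klScale klE0 n * β / (2 * M) * |(((z.1 0).valMinAbs : ℤ) : ℝ)| + klScale klE0 n * |(((z.2 0).valMinAbs : ℤ) : ℝ)| +
            klScale klE0 n * |(((z.2 1).valMinAbs : ℤ) : ℝ)|) *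
          ‖∑ Q : TorusSite 1 (2 * M) × TorusSite 2 L, (torusChar Q.1 z.1 * torusChar Q.2 z.2) •
            (F w.2.1.1 (⟨(Q.1 0).val, ZMod.val_lt (Q.1 0)⟩, Q.2) * F ℓ'.1.1 (⟨(Q.1 0).val, ZMod.val_lt (Q.1 0)⟩, Q.2) *
              g (fun i => if i = q then (w.2.1.2, w.2.2) else (ℓ'.1.2, ℓ'.2)) Q)‖ := by
  classical
  rw [show (2 - 1 : ℕ) = 1 from rfl, pow_one]
  refine mul_le_mul_of_nonneg_left ?_ (imagTimeWeight_nonneg hβ.le M)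
  obtain hq | hq : q = 0 ∨ q = 1 := Fin.exists_fin_two.mp ⟨q, rfl⟩
  · subst hq
    rw [sum_filter_pin_zero_eq_sum_vec, Fintype.sum_prod_type, Finset.sum_comm]
    refine Finset.sum_le_sum fun ℓ' _ => ?_
    have hτ : (fun i : Fin 2 => if i = (0 : Fin 2) then (w.2.1.2, w.2.2) else (ℓ'.1.2, ℓ'.2)) = ![(w.2.1.2, w.2.2), (ℓ'.1.2, ℓ'.2)] := by
      funext i; fin_cases i <;> rfl
    rw [hτ]
    exact pinSum_two_zero_le hβ F T g hker hanom n w ℓ'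
  · subst hq
    rw [sum_filter_pin_one_eq_sum_vec, Fintype.sum_prod_type, Finset.sum_comm]
    refine Finset.sum_le_sum fun ℓ' _ => ?_
    have hτ : (fun i : Fin 2 => if i = (1 : Fin 2) then (w.2.1.2, w.2.2) else (ℓ'.1.2, ℓ'.2)) = ![(ℓ'.1.2, ℓ'.2), (w.2.1.2, w.2.2)] := by
      funext i; fin_cases i <;> rfl
    rw [hτ]
    exact pinSum_two_one_le hβ F T g hker hanom n w ℓ'

/-- **THE ENGINE'S INPUT-FAMILY TWO-LEG CELL** (E1 docket item (2), two-leg member; the (E2) object of row (b)'s d-free family `hE₁`): at the thin anisotropic family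
`F_J = klAnisoFamily L M β μ K klE0 J`, for ANY Grassmann element `T` with a conserving-diagonal `2`-kernel (symbols `g_τ`, anomalous strings zero), every pin `(q, w)`:
`klWtPinnedSumOf L M β μ K J 2 T q w ≤ ε_x·Σ_{ℓ′} Σ_z w_J(z)·‖Σ_Q χ̄_Q(z)•(F_{J,ω}(Q̃)·F_{J,ω′}(Q̃)·g_{τ(q)}(Q))‖` — the cell reads the two-leg symbol ONLY on the
supports of the multipliers `F_{J,ω}·F_{J,ω′}` (space-time cutoff `C_h⁻¹(√(k₀² + e_K²))` × angular sectors; partner sectors only), through the weighted `ℓ¹` norm of ONE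
character sum per partner label, each bounded by order-three symbol data via `sliceCharSumWt_l1_le_of_data`. [cite: BenfattoGiulianiMastropietro2006, §2.7 (2.70), §2.8 (2.76), (2.81)] -/
theorem klWtPinnedSumOf_two_le_sum_momentWt_charSum {β : ℝ} (hβ : 0 < β) (μ : ℝ) (K : TrigPolyC4v) (J : ℕ) (T : HubbardGrassmann L M)
    (g : (Fin 2 → Fin 2 × Fin 2) → TorusSite 1 (2 * M) × TorusSite 2 L → ℂ)
    (hker : ∀ (τ : Fin 2 → Fin 2 × Fin 2) (k : Fin 2 → FreqMomentum L M), kernel ℂ T 2 (fun i => ((k i, (τ i).1), (τ i).2)) =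
      if ((fun _ : Fin 1 => (((k 0).1 : ℕ) : ZMod (2 * M))), (k 0).2) = (((fun _ : Fin 1 => (((k 1).1 : ℕ) : ZMod (2 * M))), (k 1).2) : TorusSite 1 (2 * M) × TorusSite 2 L)
      then g τ ((fun _ : Fin 1 => (((k 0).1 : ℕ) : ZMod (2 * M))), (k 0).2) else 0)
    (hanom : ∀ τ : Fin 2 → Fin 2 × Fin 2, (τ 0).2 = (τ 1).2 → g τ = 0)
    (q : Fin 2) (w : SpaceTimeIdx L M × SectorLeg (sectorCount J)) :
    klWtPinnedSumOf L M β μ K J 2 T q w ≤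
      imagTimeWeight β M * ∑ ℓ' : SectorLeg (sectorCount J), ∑ z : TorusSite 1 (2 * M) × TorusSite 2 L,
        (1 + klScale klE0 J * β / (2 * M) * |(((z.1 0).valMinAbs : ℤ) : ℝ)| + klScale klE0 J * |(((z.2 0).valMinAbs : ℤ) : ℝ)| +
            klScale klE0 J * |(((z.2 1).valMinAbs : ℤ) : ℝ)|) *
          ‖∑ Q : TorusSite 1 (2 * M) × TorusSite 2 L, (torusChar Q.1 z.1 * torusChar Q.2 z.2) •
            (klAnisoFamily L M β μ K klE0 J w.2.1.1 (⟨(Q.1 0).val, ZMod.val_lt (Q.1 0)⟩, Q.2) *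
                klAnisoFamily L M β μ K klE0 J ℓ'.1.1 (⟨(Q.1 0).val, ZMod.val_lt (Q.1 0)⟩, Q.2) *
              g (fun i => if i = q then (w.2.1.2, w.2.2) else (ℓ'.1.2, ℓ'.2)) Q)‖ := by
  unfold klWtPinnedSumOf
  exact wtPinnedCell_two_le_sum_momentWt_charSum hβ (klAnisoFamily L M β μ K klE0 J) T g hker hanom J q w

/-- **Interface form**: if every partner label's weighted one-pair character sum is `≤ B ℓ′` (e.g. by `sliceCharSumWt_l1_le_of_data` from order-three symbol data of
`F_{J,ω}·F_{J,ω′}·Ŵ₂` on the sector supports), the input-family two-leg cell is `≤ ε_x·Σ_{ℓ′} B ℓ′`. [cite: BenfattoGiulianiMastropietro2006, §2.8 (2.76), (2.81)] -/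
theorem klWtPinnedSumOf_two_le_of_pairBounds {β : ℝ} (hβ : 0 < β) (μ : ℝ) (K : TrigPolyC4v) (J : ℕ) (T : HubbardGrassmann L M)
    (g : (Fin 2 → Fin 2 × Fin 2) → TorusSite 1 (2 * M) × TorusSite 2 L → ℂ)
    (hker : ∀ (τ : Fin 2 → Fin 2 × Fin 2) (k : Fin 2 → FreqMomentum L M), kernel ℂ T 2 (fun i => ((k i, (τ i).1), (τ i).2)) =
      if ((fun _ : Fin 1 => (((k 0).1 : ℕ) : ZMod (2 * M))), (k 0).2) = (((fun _ : Fin 1 => (((k 1).1 : ℕ) : ZMod (2 * M))), (k 1).2) : TorusSite 1 (2 * M) × TorusSite 2 L)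
      then g τ ((fun _ : Fin 1 => (((k 0).1 : ℕ) : ZMod (2 * M))), (k 0).2) else 0)
    (hanom : ∀ τ : Fin 2 → Fin 2 × Fin 2, (τ 0).2 = (τ 1).2 → g τ = 0)
    (q : Fin 2) (w : SpaceTimeIdx L M × SectorLeg (sectorCount J)) (B : SectorLeg (sectorCount J) → ℝ)
    (hB : ∀ ℓ' : SectorLeg (sectorCount J), ∑ z : TorusSite 1 (2 * M) × TorusSite 2 L,
        (1 + klScale klE0 J * β / (2 * M) * |(((z.1 0).valMinAbs : ℤ) : ℝ)| + klScale klE0 J * |(((z.2 0).valMinAbs : ℤ) : ℝ)| +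
            klScale klE0 J * |(((z.2 1).valMinAbs : ℤ) : ℝ)|) *
          ‖∑ Q : TorusSite 1 (2 * M) × TorusSite 2 L, (torusChar Q.1 z.1 * torusChar Q.2 z.2) •
            (klAnisoFamily L M β μ K klE0 J w.2.1.1 (⟨(Q.1 0).val, ZMod.val_lt (Q.1 0)⟩, Q.2) *
                klAnisoFamily L M β μ K klE0 J ℓ'.1.1 (⟨(Q.1 0).val, ZMod.val_lt (Q.1 0)⟩, Q.2) *
              g (fun i => if i = q then (w.2.1.2, w.2.2) else (ℓ'.1.2, ℓ'.2)) Q)‖ ≤ B ℓ') :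
    klWtPinnedSumOf L M β μ K J 2 T q w ≤ imagTimeWeight β M * ∑ ℓ' : SectorLeg (sectorCount J), B ℓ' :=
  (klWtPinnedSumOf_two_le_sum_momentWt_charSum hβ μ K J T g hker hanom q w).trans
    (mul_le_mul_of_nonneg_left (Finset.sum_le_sum fun ℓ' _ => hB ℓ') (imagTimeWeight_nonneg hβ.le M))

end Summit.HubbardSuperconductivity.HubbardSuperconductivity.Theorems.TorusFourierL2

end
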